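import Literature.Barriers.AtomisticToContinuum.MostHomogeneousGroundStatesProofs
import Mathlib.NumberTheory.Real.Irrational
import Mathlib.Algebra.Order.Floor.Ring
import HarnessLib

/-!
# Narrowed barrier `Hubbard1978_mostHomogeneousNarrow` (barrier audit of `MostHomogeneousGroundStates`, 2026-08-15)

`Literature/Barriers/AtomisticToContinuum/` (D-0021 barrier catalogue), sub-problem
`Crystallization`. Companion of `MostHomogeneousGroundStates.lean` (Hubbard 1978 / Pokrovsky–Uimin
1978, Theorem 0 of Jędrzejewski–Miękisz: for a summable, repulsive, strictly convex pair
interaction on `ℤ` every most homogeneous configuration is a canonical ground-state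
configuration; entry `Hubbard1978_mostHomogeneous`, DISCHARGED in
`MostHomogeneousGroundStatesProofs.lean` as `Hubbard1978_mostHomogeneous_holds`) — so the typed
statement is a theorem and cannot be refuted; this audit is about what it BLOCKS.

**Audit (refuter, 2026-08-15).** Re-read at page level: Jędrzejewski–Miękisz 2000, abstract,
§1 (p. 3), §2 (pp. 5–6: the ground-state definition, Theorem 0, the grand-canonical paragraph),
§3 (p. 8), refs (p. 19); Miękisz 1998 §3 (pp. 5–6); Aubry, J. Physique Lett. 44 (1983) L-247,
eqs. (1)–(3), (5)–(7), (10) and pp. L-249/250 (read from the HAL scan); Burnell–Parish–Cooper–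
Sondhi 2009, abstract and eq. (2); Fisher–Szpilka 1987 §IV (4.8)–(4.12); the tree's effective
stacking functional `Literature/MathematicalPhysics/StatisticalMechanics/HaggStacking.lean`.
Verdict: NARROWED. The parent's BARRIER block says the result blocks "the expectation … that
one-dimensional effective models have periodic minimisers" for the technique class
`periodic-ansatz-1d period-scanning finite-coupling-truncation periodic-minimiser-assumption …
stacking-sequence-effective-model hagg-sequence-reduction`. The printed result defeats the
periodic ansatz in exactly two situations, both EXCEPTIONAL, and in neither does a periodic
scan miss the ground-state energy:

1. CANONICAL ENSEMBLE, IRRATIONAL DENSITY (clause (3), proved). At a prescribed irrational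
   density the ground states are the aperiodic hull configurations `x_n = ⌊n l + α⌋`
   [cite: Aubry1983LatticeGas, eq. (3) (p. L-248)] — but there no periodic configuration is even
   ADMISSIBLE: a translation symmetry of a bi-infinite increasing enumeration is an index shift
   `x(i + p) = x(i) + q` (`exists_period_of_isPeriodicConfig`), whose mean gap is the rational
   `q/p` (`mean_gap_of_periodic` of the parent file). Aperiodicity is forced by arithmetic, not won
   energetically against periodic competitors. At every RATIONAL density `p/q` the same hull
   formula gives a `q`-periodic most homogeneous ground state (clause (2), proved): "for any
   rational `ρ`, there is a unique (up to translations) periodic ground-state configuration with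
   that density" [cite: Miekisz1998, §3 (p. 5)], "the ground state is periodic with period `q`"
   [cite: BurnellParishCooperSondhi2009, "Model" paragraph (citing Hubbard1978, BurkovSinai1983)] — a scan
   over the single period `q` finds it.
2. GRAND-CANONICAL ENSEMBLE, EXCEPTIONAL CHEMICAL POTENTIAL (cited, not typed). "To have a
   ground state with an irrational density `ρ` of particles, one has to fix `μ(ρ) = de(ρ)/dρ`.
   For any rational `ρ`, there is a closed interval of chemical potentials … One can show that
   the sum of lengths of these intervals amounts to the length of the [whole] interval"
   [cite: JedrzejewskiMiekisz2000, §2 (p. 6)], "We have obtained a complete devil's staircase"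
   [cite: Miekisz1998, §3 (p. 5)]; Burkov's set `M₁` of such `μ` "has measure zero which means, in
   our terminology, that the devil's staircase is complete", with the rigorous proof in Aubry's
   J. Phys. C paper [cite: Aubry1983LatticeGas, pp. L-249–L-250 and ref. [6]]
   [cite: Aubry1983CompleteStaircase, as cited there (not re-read)] [cite: BakBruinsma1982, as cited in JedrzejewskiMiekisz2000 §2];
   "every commensurate state at a rational filling is stable over a finite interval in chemical
   potential … and the total measure of all such intervals exhausts the full range of `μ`", the
   width of the plateau of denominator `q` being `∑_n nq [V(nq+1) + V(nq-1) - 2V(nq)] > 0`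
   [cite: BurnellParishCooperSondhi2009, abstract and eq. (2)] (cf. `ΔΣ_l = l Δ²W₂(l)`,
   [cite: FisherSzpilka1987, §IV (4.12)]). So the `μ` at which no periodic ground state exists
   form a closed Lebesgue-null — hence nowhere dense — subset of the staircase interval: every
   aperiodic grand-canonical ground state is destroyed by an arbitrarily small change of `μ`,
   while every periodic one persists on an open plateau.
3. NO CONSTRAINT AT ALL (clause (1), proved). "Of course, if we do not fix the density,
   particles want to be as far one from another as possible, so the vacuum is the only ground
   state" [cite: Miekisz1998, §3 (p. 5)]: the unconstrained functional — the analogue of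
   minimising a stacking energy over ALL sequences — has a (trivially periodic) minimiser; the
   vacuum is also the grand-canonical ground state for `μ ≤ 0` (`isGCGroundStateConfig_vacuum`).
4. THE VALUE IS NEVER MISSED. `e(ρ) = ρ ∑_m ψ_m(1/ρ)` with `ψ_m(l) = (ml - ⌊ml⌋)[U_m(1 + ⌊ml⌋)
   - U_m(⌊ml⌋)] + U_m(⌊ml⌋)` piecewise linear in `l` [cite: Aubry1983LatticeGas, eqs. (5)–(7)],
   and `e` is convex [cite: JedrzejewskiMiekisz2000, §2 (p. 6)], hence continuous on `(0,1)`: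
   the infimum of `e - μρ` over PERIODIC configurations (rational `ρ`, clause (2)) equals the
   ground-state energy density at every `μ`; a period scan can fail only to ATTAIN it, and only
   on the null set of item 2.
5. OUTSIDE THE CLASS. The effective stacking functional of the Crystallization routes,
   `H_n(J, s) = ∑_{m<n} ∑_{k≥2} J_k · 1[s_m + ⋯ + s_{m+k-1} ≡ 0 (3)]` on Hägg sequences
   (`Literature.MathematicalPhysics.StatisticalMechanics.haggEnergy`), is a MANY-body
   interaction in the spins `s` (two-body only in the `ℤ/3`-valued height with the hard-core
   rule `h_{m+1} ≠ h_m`), carries no conserved density and no chemical potential, and its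
   couplings need be neither positive nor convex: Hubbard's theorem covers
   `stacking-sequence-effective-model` / `hagg-sequence-reduction` only by ANALOGY (the parent's
   `scope_caveats` already concede sign and convexity) — and within its own class the analogy
   predicts LOCKING into a periodic phase off a null parameter set, not aperiodicity.

Contents: the unconstrained and grand-canonical ground-state predicates (`IsGroundStateConfig`,
`relHamiltonianGC`, `IsGCGroundStateConfig`, each implying `IsCanonicalGroundStateConfig`); the
vacuum lemmas; Aubry's hull enumeration `hullConfig l φ i = ⌊i l + φ⌋` with balancedness
(`hullConfig_gap`), `isMostHomogeneous_hullConfig`, the ground-state property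
(`isCanonicalGroundStateConfig_hullConfig`, from the discharged Theorem 0), `q`-periodicity at
rational slope (`isPeriodicConfig_hullConfig_rat`), the index-shift lemma
(`exists_period_of_isPeriodicConfig`) and aperiodicity at irrational slope
(`not_isPeriodicConfig_hullConfig`); the entry `Hubbard1978_mostHomogeneousNarrow` with its
BARRIER block, proved (`hubbard1978_mostHomogeneousNarrow_holds`, axioms `propext`,
`Classical.choice`, `Quot.sound`).

## References

* [JedrzejewskiMiekisz2000] J. Jędrzejewski, J. Miękisz, *Ground states of lattice gases with
  "almost" convex repulsive interactions*, J. Stat. Phys. 98 (2000) 589–620,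
  arXiv:cond-mat/9903163: abstract, §1 (p. 3), §2 (pp. 5–6, Theorem 0), §3 (p. 8).
* [Miekisz1998] J. Miękisz, *An ultimate frustration in classical lattice-gas models*, J. Stat.
  Phys. 90 (1998), arXiv:cond-mat/9706293: §3 (pp. 5–6).
* [Aubry1983LatticeGas] S. Aubry, *Complete devil's staircase in the one-dimensional lattice
  gas*, J. Physique Lett. 44 (1983) L-247–L-250 (HAL jpa-00232188): eqs. (1)–(3), (5)–(7), (10),
  pp. L-249/250.
* [Aubry1983CompleteStaircase] S. Aubry, *Exact models with a complete Devil's staircase*,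
  J. Phys. C 16 (1983) 2497 (the completeness proof; cited through the above, not re-read).
* [BakBruinsma1982] P. Bak, R. Bruinsma, Phys. Rev. Lett. 49 (1982) 249 (cited through
  JedrzejewskiMiekisz2000 and BurnellParishCooperSondhi2009; not re-read).
* [BurkovSinai1983] S. E. Burkov, Ya. G. Sinai, Russian Math. Surveys 38:4 (1983) 235–257
  (rigorous phase diagram, uniqueness up to translations; cited through BurnellParishCooperSondhi2009; not re-read).
* [Hubbard1978] J. Hubbard, Phys. Rev. B 17 (1978) 494 (cited through the above).
* [BurnellParishCooperSondhi2009] F. J. Burnell, M. M. Parish, N. R. Cooper, S. L. Sondhi,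
  *Devil's staircases and supersolids in a one-dimensional dipolar Bose gas*, Phys. Rev. B 80
  (2009) 174519, arXiv:0901.4366: abstract, "Model" paragraph and eq. (2).
* [FisherSzpilka1987] M. E. Fisher, A. M. Szpilka, *Domain-wall interactions. I*, Phys. Rev. B 36
  (1987) 644: §IV, (4.8)–(4.12).
* [Radin1991] C. Radin, *Global order from local sources*, Bull. AMS 24 (1991): §3a (p. 9) (as quoted in the parent entry; not re-read).
-/

noncomputable section

open scoped BigOperators

namespace Literature.Barriers.AtomisticToContinuum.HubbardChain

/-! ### Ground states without the particle-number constraint -/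

/-- **Ground-state configuration** in the sense of Jędrzejewski–Miękisz, WITHOUT particle
conservation: "`X` is a ground-state configuration of `H` if `H(Y,X) ≥ 0` for any `Y ∼ X`"
(every local excitation off a finite `Λ`). [cite: JedrzejewskiMiekisz2000, §2 (p. 5)] -/
def IsGroundStateConfig (V : ℕ → ℝ) (X : ℤ → Bool) : Prop :=
  ∀ (Λ : Finset ℤ) (Y : ℤ → Bool), (∀ i ∉ Λ, Y i = X i) → 0 ≤ relHamiltonian V Λ Y X

/-- **Grand-canonical relative Hamiltonian** `H(Y, X) - μ (N_Λ(Y) - N_Λ(X))` with chemical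
potential `μ` ("we introduce a chemical potential `h > 0` and pass to the grand-canonical
ensemble … we have to minimize `f(ρ) = e(ρ) - hρ`"). [cite: Miekisz1998, §3 (p. 5)]
[cite: Aubry1983LatticeGas, eq. (1) (p. L-248)] -/
def relHamiltonianGC (V : ℕ → ℝ) (μ : ℝ) (Λ : Finset ℤ) (Y X : ℤ → Bool) : ℝ :=
  relHamiltonian V Λ Y X -
    μ * (((Λ.filter fun i => Y i).card : ℝ) - ((Λ.filter fun i => X i).card : ℝ))

/-- **Grand-canonical ground-state configuration** at chemical potential `μ`: every local
excitation (particle number free) has `H(Y,X) - μ ΔN ≥ 0`. [cite: Miekisz1998, §3 (p. 5)]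
[cite: JedrzejewskiMiekisz2000, §2 (pp. 5–6)] -/
def IsGCGroundStateConfig (V : ℕ → ℝ) (μ : ℝ) (X : ℤ → Bool) : Prop :=
  ∀ (Λ : Finset ℤ) (Y : ℤ → Bool), (∀ i ∉ Λ, Y i = X i) → 0 ≤ relHamiltonianGC V μ Λ Y X

/-- A ground-state configuration (all local excitations) is in particular a canonical one
(particle-conserving excitations only). [folklore] -/
theorem IsGroundStateConfig.isCanonical {V : ℕ → ℝ} {X : ℤ → Bool} (h : IsGroundStateConfig V X) :
    IsCanonicalGroundStateConfig V X :=
  fun Λ Y hY _ => h Λ Y hY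

/-- A grand-canonical ground-state configuration (any `μ`) is a canonical one: on
particle-conserving excitations the `μ`-term vanishes. [folklore] -/
theorem IsGCGroundStateConfig.isCanonical {V : ℕ → ℝ} {μ : ℝ} {X : ℤ → Bool}
    (h : IsGCGroundStateConfig V μ X) : IsCanonicalGroundStateConfig V X := by
  intro Λ Y hY hcard
  have := h Λ Y hY
  simp only [relHamiltonianGC, hcard, sub_self, mul_zero, sub_zero] at this
  exact this

/-- Pair energies of a repulsive interaction are nonnegative. [folklore] -/
theorem pairEnergy_nonneg {V : ℕ → ℝ} (hV : ∀ n, 1 ≤ n → 0 ≤ V n) (X : ℤ → Bool) {i j : ℤ}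
    (hij : i < j) : 0 ≤ pairEnergy V X i j := by
  unfold pairEnergy
  split_ifs
  · exact hV _ (by omega)
  · exact le_rfl

/-- The vacuum has no pairs: `pairEnergy V ∅ i j = 0`. [folklore] -/
theorem pairEnergy_vacuum (V : ℕ → ℝ) (i j : ℤ) : pairEnergy V (fun _ => false) i j = 0 := by
  simp [pairEnergy]

/-- **"If we do not fix the density … the vacuum is the only ground state"**: for a repulsive
interaction the relative Hamiltonian of ANY local excitation of the vacuum is `≥ 0`.
[cite: Miekisz1998, §3 (p. 5)] -/
theorem relHamiltonian_vacuum_nonneg {V : ℕ → ℝ} (hV : ∀ n, 1 ≤ n → 0 ≤ V n) (Λ : Finset ℤ)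
    (Y : ℤ → Bool) : 0 ≤ relHamiltonian V Λ Y (fun _ => false) := by
  unfold relHamiltonian
  refine tsum_nonneg fun p => ?_
  rw [pairEnergy_vacuum, sub_zero]
  exact pairEnergy_nonneg hV Y p.2.1

/-- The vacuum is a ground-state configuration (no particle constraint) of every repulsive
interaction, in particular of every Hubbard potential. [cite: Miekisz1998, §3 (p. 5)] -/
theorem isGroundStateConfig_vacuum {V : ℕ → ℝ} (hV : ∀ n, 1 ≤ n → 0 ≤ V n) :
    IsGroundStateConfig V fun _ => false :=
  fun Λ Y _ => relHamiltonian_vacuum_nonneg hV Λ Y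

/-- The vacuum is a grand-canonical ground-state configuration for every `μ ≤ 0` (the half-line
"where the vacuum is the only ground-state configuration" begins at the left end of the
staircase). [cite: JedrzejewskiMiekisz2000, §2 (p. 6)] [cite: Miekisz1998, §3 (p. 5)] -/
theorem isGCGroundStateConfig_vacuum {V : ℕ → ℝ} (hV : ∀ n, 1 ≤ n → 0 ≤ V n) {μ : ℝ}
    (hμ : μ ≤ 0) : IsGCGroundStateConfig V μ fun _ => false := by
  intro Λ Y _
  unfold relHamiltonianGC
  have h1 := relHamiltonian_vacuum_nonneg hV Λ Y
  have h2 : (0 : ℝ) ≤ ((Λ.filter fun i => Y i).card : ℝ) := by positivity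
  have h3 : ((Λ.filter fun i => (fun _ : ℤ => false) i).card : ℝ) = 0 := by simp
  rw [h3, sub_zero]
  nlinarith

/-! ### Aubry's hull form of the most homogeneous configurations -/

/-- **The hull (Beatty / Sturmian) enumeration** `x_n = Int(n l + α)` of mean gap `l = 1/ρ` and
phase `α`: "when the atomic mean distance `l` … is fixed, the ground-state of model (1) is given
by `x_n = Int(nl + α)` where `α` is an arbitrary phase". [cite: Aubry1983LatticeGas, eq. (3) (p. L-248)] -/
def hullConfig (l φ : ℝ) (i : ℤ) : ℤ :=
  ⌊(i : ℝ) * l + φ⌋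

/-- The `n`-th neighbour gaps of a hull enumeration take only the two values `⌊n l⌋`,
`⌊n l⌋ + 1` (balancedness of Sturmian sequences). [folklore] -/
theorem hullConfig_gap (l φ : ℝ) (i : ℤ) (n : ℕ) :
    hullConfig l φ (i + n) - hullConfig l φ i = ⌊(n : ℝ) * l⌋ ∨
      hullConfig l φ (i + n) - hullConfig l φ i = ⌊(n : ℝ) * l⌋ + 1 := by
  unfold hullConfig
  have e : ((i + (n : ℤ) : ℤ) : ℝ) * l + φ = ((i : ℝ) * l + φ) + (n : ℝ) * l := by
    push_cast; ring
  rw [e]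
  have h1 := Int.le_floor_add ((i : ℝ) * l + φ) ((n : ℝ) * l)
  have h2 := Int.le_floor_add_floor ((i : ℝ) * l + φ) ((n : ℝ) * l)
  omega

/-- For mean gap `l ≥ 1` the hull enumeration is strictly increasing (consecutive gaps are
`⌊l⌋ ≥ 1` or `⌊l⌋ + 1`). [folklore] -/
theorem strictMono_hullConfig {l : ℝ} (hl : 1 ≤ l) (φ : ℝ) : StrictMono (hullConfig l φ) := by
  refine strictMono_int_of_lt_succ fun i => ?_
  have h := hullConfig_gap l φ i 1
  have hfl : (1 : ℤ) ≤ ⌊((1 : ℕ) : ℝ) * l⌋ := Int.le_floor.2 (by push_cast; linarith)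
  push_cast at h hfl
  omega

/-- **Hull enumerations are most homogeneous** (generalized Wigner lattices), for every mean gap
`l ≥ 1` and phase. [cite: Aubry1983LatticeGas, eq. (3) (p. L-248)] [cite: JedrzejewskiMiekisz2000, §2 (p. 6)] -/
theorem isMostHomogeneous_hullConfig {l : ℝ} (hl : 1 ≤ l) (φ : ℝ) :
    IsMostHomogeneous (hullConfig l φ) :=
  ⟨strictMono_hullConfig hl φ, fun n _ => ⟨⌊(n : ℝ) * l⌋, fun i => hullConfig_gap l φ i n⟩⟩

/-- By the discharged Theorem 0 (`Hubbard1978_mostHomogeneous_holds`), every hull configuration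
of mean gap `l ≥ 1` is a canonical ground-state configuration of every Hubbard potential.
[cite: JedrzejewskiMiekisz2000, §2 Theorem 0 (p. 6)] -/
theorem isCanonicalGroundStateConfig_hullConfig {V : ℕ → ℝ} (hV : IsHubbardPotential V) {l : ℝ}
    (hl : 1 ≤ l) (φ : ℝ) : IsCanonicalGroundStateConfig V (configOf (hullConfig l φ)) :=
  Hubbard1978_mostHomogeneous_holds V hV _ (isMostHomogeneous_hullConfig hl φ)

/-! ### Periodicity: rational versus irrational density -/

/-- **Periodic configuration**: invariant under a nonzero lattice translation. [folklore] -/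
def IsPeriodicConfig (X : ℤ → Bool) : Prop :=
  ∃ q : ℤ, 0 < q ∧ ∀ j, X (j + q) = X j

/-- Rational mean gap `q/p`: the hull enumeration is `p`-periodic up to the translation `q`,
`x(i + p) = x(i) + q` ("If the particle density is rational, then the corresponding most
homogeneous configurations are periodic"). [cite: JedrzejewskiMiekisz2000, §2 (p. 6)] -/
theorem hullConfig_add_period {p : ℕ} (hp : 0 < p) (q : ℤ) (φ : ℝ) (i : ℤ) :
    hullConfig ((q : ℝ) / p) φ (i + p) = hullConfig ((q : ℝ) / p) φ i + q := by
  unfold hullConfig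
  have hp' : (p : ℝ) ≠ 0 := by positivity
  have e : ((i + (p : ℤ) : ℤ) : ℝ) * ((q : ℝ) / p) + φ = ((i : ℝ) * ((q : ℝ) / p) + φ) + (q : ℤ) := by
    push_cast
    field_simp
    ring
  rw [e, Int.floor_add_intCast]

/-- An enumeration that is periodic up to translation has a periodic configuration. [folklore] -/
theorem isPeriodicConfig_of_enumeration {x : ℤ → ℤ} {p q : ℤ} (hq : 0 < q)
    (h : ∀ i, x (i + p) = x i + q) : IsPeriodicConfig (configOf x) := by
  refine ⟨q, hq, fun j => ?_⟩
  rw [Bool.eq_iff_iff, configOf_eq_true_iff, configOf_eq_true_iff]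
  constructor
  · rintro ⟨i, hi⟩
    refine ⟨i - p, ?_⟩
    have := h (i - p)
    rw [sub_add_cancel] at this
    omega
  · rintro ⟨i, hi⟩
    exact ⟨i + p, by rw [h i, hi]⟩

/-- At rational density `p/q` (`0 < p ≤ q`, mean gap `q/p ≥ 1`) the hull configurations are
`q`-PERIODIC. [cite: JedrzejewskiMiekisz2000, §2 (p. 6)] [cite: Miekisz1998, §3 (p. 5)] -/
theorem isPeriodicConfig_hullConfig_rat {p : ℕ} (hp : 0 < p) {q : ℤ} (hq : 0 < q) (φ : ℝ) :
    IsPeriodicConfig (configOf (hullConfig ((q : ℝ) / p) φ)) :=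
  isPeriodicConfig_of_enumeration hq (hullConfig_add_period hp q φ)

/-- A translation symmetry of the configuration of a strictly increasing bi-infinite enumeration
is an index shift: if `configOf x` is `q`-periodic (`q > 0`) then `x(i + p) = x(i) + q` for some
`p ≥ 1` (an order automorphism of `ℤ` is a translation). [folklore] -/
theorem exists_period_of_isPeriodicConfig {x : ℤ → ℤ} (hx : StrictMono x)
    (hX : IsPeriodicConfig (configOf x)) :
    ∃ (p : ℕ) (q : ℤ), 0 < p ∧ 0 < q ∧ ∀ i, x (i + p) = x i + q := by
  obtain ⟨q, hq, hper⟩ := hX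
  have hmem : ∀ j, j + q ∈ Set.range x ↔ j ∈ Set.range x := fun j => by
    rw [← configOf_eq_true_iff, ← configOf_eq_true_iff, hper j]
  -- the index map `σ` with `x (σ i) = x i + q`
  have hex : ∀ i, ∃ k, x k = x i + q := fun i => by
    obtain ⟨k, hk⟩ := (hmem (x i)).2 ⟨i, rfl⟩
    exact ⟨k, hk⟩
  choose σ hσ using hex
  have hσmono : StrictMono σ := fun i j hij => by
    have h := hx hij
    have : x (σ i) < x (σ j) := by rw [hσ, hσ]; omega
    exact hx.lt_iff_lt.1 this
  have hσsurj : ∀ k, ∃ i, σ i = k := fun k => by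
    obtain ⟨i, hi⟩ := (hmem (x k - q)).1 (by rw [sub_add_cancel]; exact ⟨k, rfl⟩)
    refine ⟨i, hx.injective ?_⟩
    rw [hσ, hi, sub_add_cancel]
  have hstep : ∀ i, σ (i + 1) = σ i + 1 := fun i => by
    have h1 : σ i < σ (i + 1) := hσmono (by omega)
    by_contra hne
    obtain ⟨m, hm⟩ := hσsurj (σ i + 1)
    have h2 : σ i < σ m := by omega
    have h3 : σ m < σ (i + 1) := by omega
    have h4 := hσmono.lt_iff_lt.1 h2
    have h5 := hσmono.lt_iff_lt.1 h3
    omega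
  have hshift : ∀ i, σ i = σ 0 + i := fun i => by
    induction i using Int.induction_on with
    | zero => simp
    | succ k ih => rw [hstep, ih]; ring
    | pred k ih =>
      have := hstep (-(k : ℤ) - 1)
      rw [show -(k : ℤ) - 1 + 1 = -k by ring] at this
      omega
  have hσ0 : 0 < σ 0 := by
    have : x 0 < x (σ 0) := by rw [hσ]; linarith
    exact hx.lt_iff_lt.1 this
  refine ⟨(σ 0).toNat, q, by omega, hq, fun i => ?_⟩
  have e : i + ((σ 0).toNat : ℤ) = σ i := by rw [hshift i]; omega
  rw [e, hσ]

/-- **Irrational density: NONPERIODIC** ("while for irrational densities they are nonperiodic"):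
no lattice translation leaves a hull configuration of irrational mean gap invariant — a
translation symmetry would force `x(kp) - x(0) = kq`, i.e. `|k(pl - q)| < 1` for all `k`, so
`l = q/p`. [cite: JedrzejewskiMiekisz2000, §2 (p. 6)] [cite: Miekisz1998, §3 (p. 5)] -/
theorem not_isPeriodicConfig_hullConfig {l : ℝ} (hl : 1 ≤ l) (hirr : Irrational l) (φ : ℝ) :
    ¬ IsPeriodicConfig (configOf (hullConfig l φ)) := by
  intro hX
  obtain ⟨p, q, hp, hq, hper⟩ := exists_period_of_isPeriodicConfig (strictMono_hullConfig hl φ) hX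
  have hmean := mean_gap_of_periodic (x := hullConfig l φ) (p := p) (q := q)
    (fun i => by rw [hper i]; ring)
  set d : ℝ := (p : ℝ) * l - q with hd
  have hbound : ∀ k : ℕ, |(k : ℝ) * d| < 1 := by
    intro k
    have hk := hmean k
    unfold hullConfig at hk
    set A : ℝ := (((k : ℤ) * (p : ℤ) : ℤ) : ℝ) * l + φ with hA
    set B : ℝ := (((0 : ℤ)) : ℝ) * l + φ with hB
    have hA1 := Int.floor_le A
    have hA2 := Int.lt_floor_add_one A
    have hB1 := Int.floor_le B
    have hB2 := Int.lt_floor_add_one B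
    have hkR : ((⌊A⌋ - ⌊B⌋ : ℤ) : ℝ) = (k : ℝ) * q := by
      rw [hk]; push_cast; ring
    push_cast at hkR
    have hAB : A - B = (k : ℝ) * p * l := by
      simp only [hA, hB]; push_cast; ring
    have hkd : (k : ℝ) * d = (A - B) - ((⌊A⌋ : ℝ) - ⌊B⌋) := by
      rw [hAB, hkR, hd]; ring
    rw [hkd, abs_lt]
    constructor <;> linarith
  have hd0 : d = 0 := by
    by_contra hne
    have hpos : 0 < |d| := abs_pos.2 hne
    obtain ⟨k, hk⟩ := exists_nat_gt (1 / |d|)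
    have h1 : 1 < (k : ℝ) * |d| := by
      have := (div_lt_iff₀ hpos).1 hk
      linarith
    have h2 := hbound k
    rw [abs_mul, Nat.abs_cast] at h2
    linarith
  have hl' : l = (q : ℝ) / (p : ℝ) := by
    have hp' : (p : ℝ) ≠ 0 := by positivity
    field_simp
    simp only [hd] at hd0
    linarith
  exact hirr.ne_rat ((q : ℚ) / (p : ℚ)) (by rw [hl']; push_cast; ring)

/-! ### The narrowed barrier -/

/-- **Hubbard's generalized Wigner lattices — where exactly the periodic ansatz fails
(barrier audit 2026-08-15, narrowing `Hubbard1978_mostHomogeneous`).** For every interaction `V`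
of Hubbard's class `V₁` (summable, repulsive, strictly convex from distance `1` on):

(1) NO CONSTRAINT: the vacuum is a ground-state configuration for ALL local excitations, particle
number free ("if we do not fix the density … the vacuum is the only ground state"
[cite: Miekisz1998, §3 (p. 5)]);

(2) RATIONAL DENSITY `p/q` (`0 < p ≤ q`): Aubry's hull configuration `{⌊i q/p + φ⌋ : i ∈ ℤ}`
[cite: Aubry1983LatticeGas, eq. (3) (p. L-248)] is most homogeneous, a canonical ground-state
configuration, and `q`-PERIODIC ("If the particle density is rational, then the corresponding
most homogeneous configurations are periodic" [cite: JedrzejewskiMiekisz2000, §2 (p. 6)]);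

(3) IRRATIONAL MEAN GAP `l ≥ 1`: the hull configuration `{⌊i l + φ⌋}` is most homogeneous, a
canonical ground-state configuration, and invariant under NO lattice translation ("while for
irrational densities they are nonperiodic" [cite: JedrzejewskiMiekisz2000, §2 (p. 6)]) — and at
that density no periodic configuration is admissible at all (`exists_period_of_isPeriodicConfig`
with `mean_gap_of_periodic`).

BARRIER (D-0021), AtomisticToContinuum/Crystallization:
* technique_class: periodic-minimiser-assumption-at-prescribed-irrational-density periodic-ansatz-1d-canonical exceptional-chemical-potential one-dimensional-long-range-lattice-gas two-body-convex-repulsive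
* blocks: ONLY (i) canonical-ensemble arguments for a one-dimensional lattice gas of Hubbard's class at a PRESCRIBED IRRATIONAL density that posit a periodic minimiser — there none is admissible and the ground states are the aperiodic hull (Sturmian) configurations (clause (3)) [cite: JedrzejewskiMiekisz2000, §2 Theorem 0 (p. 6)] [cite: Aubry1983LatticeGas, eq. (3) (p. L-248)]; (ii) grand-canonical arguments at the EXCEPTIONAL chemical potentials `μ(ρ) = de(ρ)/dρ`, `ρ` irrational, a closed Lebesgue-null (hence nowhere dense) subset of the staircase interval, since the rational plateaux `[d⁻e/dρ, d⁺e/dρ]` have lengths summing to the whole interval — the COMPLETE devil's staircase [cite: JedrzejewskiMiekisz2000, §2 (p. 6)] [cite: Miekisz1998, §3 (p. 5)] [cite: Aubry1983LatticeGas, pp. L-249–L-250] [cite: BurnellParishCooperSondhi2009, abstract and eq. (2)]. NOT blocked: unconstrained minimisation (clause (1)); any rational density or any `μ` interior to a plateau (Lebesgue-a.e. `μ`; plateau of denominator `q` of width `∑_n nq[V(nq+1)+V(nq-1)-2V(nq)] > 0` [cite: BurnellParishCooperSondhi2009, eq. (2)]), where the ground state is the `q`-periodic hull configuration, unique up to translations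 [cite: Miekisz1998, §3 (p. 5)] [cite: BurnellParishCooperSondhi2009, "Model" paragraph (citing BurkovSinai1983)], found by scanning the single period `q`; and period-scanning as a computation of the ground-state ENERGY, which it never misses: `e(ρ) = ρ∑_m ψ_m(1/ρ)` with `ψ_m` piecewise linear [cite: Aubry1983LatticeGas, eqs. (5)–(7)], `e` convex [cite: JedrzejewskiMiekisz2000, §2 (p. 6)], so `inf` over periodic configurations of `e - μρ` is the ground-state value at every `μ` — only its ATTAINMENT fails, and only on the null set (ii)
* because: (1) repulsion alone: `H(Y, ∅) = ∑` pair energies of `Y ≥ 0` (`relHamiltonian_vacuum_nonneg`); (2)–(3) Theorem 0, discharged (`Hubbard1978_mostHomogeneous_holds`: Hubbard's supporting-line convexity argument [cite: JedrzejewskiMiekisz2000, §3 (p. 8) and Appendix Lemma A1]) applied to the balanced enumerations `⌊il + φ⌋` (`⌊a⌋ + ⌊b⌋ ≤ ⌊a+b⌋ ≤ ⌊a⌋ + ⌊b⌋ + 1`, `hullConfig_gap`); `⌊(i+p)q/p + φ⌋ = ⌊iq/p + φ⌋ + q` (`hullConfig_add_period`); a translation symmetry of the configuration of a bi-infinite increasing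 enumeration is an index shift (an order automorphism of `ℤ` is a translation, `exists_period_of_isPeriodicConfig`), forcing `|k(pl - q)| < 1` for all `k`, i.e. `l = q/p` (`not_isPeriodicConfig_hullConfig`); completeness of the staircase: plateau lengths sum to the full interval [cite: JedrzejewskiMiekisz2000, §2 (p. 6)], Burkov's exceptional set "`M₁` has measure zero which means … that the devil's staircase is complete", proof in [cite: Aubry1983CompleteStaircase, via Aubry1983LatticeGas ref. [6] (not re-read)]
* evasions_known: (a) drop the density constraint / chemical potential (zero-pressure, unconstrained minimisation over all configurations): the vacuum, clause (1) [cite: Miekisz1998, §3 (p. 5)]; (b) rational density, or `μ` in a plateau — a set of full measure with dense interior: unique periodic ground state [cite: Miekisz1998, §3 (p. 5)] [cite: JedrzejewskiMiekisz2000, §2 (p. 6)]; (c) finite range: "every 1 dimensional problem has a periodic ground state" [cite: Radin1991, §3a (p. 9), as quoted in the parent entry], "for any finite-range interaction in one dimension, there exists at least one periodic ground-state configuration … Hence a devil's staircase cannot appear" [cite: Miekisz1998, §3 (p. 6)]; (d) leave the class: the Crystallization routes' effective stacking functional `∑_k J_k 1[s_m+⋯+s_{m+k-1} ≡ 0 (3)]`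 on Hägg sequences (tree: `Literature.MathematicalPhysics.StatisticalMechanics.haggEnergy`, [cite: PartayOrtnerCsanyi2017, §1 and Appendix A]) is many-body in the spins, unconstrained (no density, no `μ`) and of unrestricted sign/convexity — Theorem 0 says nothing about it, and its own lesson for such a model is locking into a periodic phase for all but a null set of any one field-like parameter
* scope_caveats: (a) typed and PROVED: clauses (1)–(3) (only repulsion is used in (1); (2)–(3) use the discharged Theorem 0, i.e. convexity and repulsion; summability makes the Hamiltonians converge); (b) NOT typed, citation only: completeness of the staircase (measure-zero exceptional set), plateau widths, uniqueness of the ground-state measure at each `μ` [cite: Miekisz1998, §3 Theorem 2 (p. 5)], and the converse half of Theorem 0 (every strictly ergodic canonical ground state is most homogeneous) — as in the parent; Aubry's J. Phys. C proof and Burkov–Sinai were not re-read (acquisition requests filed); (c) "periodic" = invariance of the configuration under a nonzero translation (`IsPeriodicConfig`); clause (3) is stated for the hull configurations of every phase `φ` (all of them ground states; uncountably many [cite: Miekisz1998, §3 (p. 5)]); (d) continuum displacive models are different: for the Frenkel–Kontorova model with a small periodic potential the staircase is INCOMPLETE (incommensurate ground states on a set of parameters of positive measure) [cite: Aubry1983LatticeGas,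 p. L-250] — genericity of locking is a LATTICE (discrete-configuration) phenomenon, which is the stacking-sequence side of the analogy; (e) nothing here decides whether the Lennard-Jones stacking couplings sit at an exceptional point of THEIR model — that is the routes' open crux (Hägg domination `|J₂| > ∑_{k≥3}|J_k|`), on which Hubbard's theorem is silent either way
* status: established — clauses (1)–(3) proved below (`hubbard1978_mostHomogeneousNarrow_holds`); parent entry discharged (`Hubbard1978_mostHomogeneous_holds`); completeness/uniqueness: [cite: Aubry1983LatticeGas, pp. L-249–L-250] [cite: BakBruinsma1982, as cited in JedrzejewskiMiekisz2000 §2] [cite: BurkovSinai1983, as cited in BurnellParishCooperSondhi2009]; no dissent found (searches: "complete devil's staircase" lattice gas, Bak–Bruinsma, Burkov–Sinai, Aubry 1983, Hubbard generalized Wigner lattice, Miękisz quasicrystal ground states; galaxy `--star all`)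

[cite: JedrzejewskiMiekisz2000, §2 Theorem 0 (p. 6)] [cite: Aubry1983LatticeGas, eq. (3) (p. L-248)] -/
def Hubbard1978_mostHomogeneousNarrow : Prop :=
  (∀ V : ℕ → ℝ, IsHubbardPotential V → IsGroundStateConfig V fun _ => false) ∧
  (∀ V : ℕ → ℝ, IsHubbardPotential V → ∀ (p : ℕ) (q : ℤ) (φ : ℝ), 0 < p → (p : ℤ) ≤ q →
      IsMostHomogeneous (hullConfig ((q : ℝ) / p) φ) ∧
        IsCanonicalGroundStateConfig V (configOf (hullConfig ((q : ℝ) / p) φ)) ∧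
          IsPeriodicConfig (configOf (hullConfig ((q : ℝ) / p) φ))) ∧
  (∀ V : ℕ → ℝ, IsHubbardPotential V → ∀ l φ : ℝ, 1 ≤ l → Irrational l →
      IsMostHomogeneous (hullConfig l φ) ∧
        IsCanonicalGroundStateConfig V (configOf (hullConfig l φ)) ∧
          ¬ IsPeriodicConfig (configOf (hullConfig l φ)))

/-- PROOF of the narrowed entry: (1) `isGroundStateConfig_vacuum`; (2) `isMostHomogeneous_hullConfig`,
`isCanonicalGroundStateConfig_hullConfig` (the discharged Theorem 0) and
`isPeriodicConfig_hullConfig_rat`; (3) the same with `not_isPeriodicConfig_hullConfig`.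
[cite: JedrzejewskiMiekisz2000, §2 Theorem 0 (p. 6)] [cite: Aubry1983LatticeGas, eq. (3) (p. L-248)] -/
theorem hubbard1978_mostHomogeneousNarrow_holds : Hubbard1978_mostHomogeneousNarrow := by
  refine ⟨fun V hV => isGroundStateConfig_vacuum fun n hn => (hV.2.1 n hn).le, ?_, ?_⟩
  · intro V hV p q φ hp hpq
    have hq : 0 < q := by omega
    have hl : (1 : ℝ) ≤ (q : ℝ) / p := by
      rw [le_div_iff₀ (by exact_mod_cast hp)]
      simpa using (show ((p : ℤ) : ℝ) ≤ (q : ℝ) by exact_mod_cast hpq)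
    exact ⟨isMostHomogeneous_hullConfig hl φ, isCanonicalGroundStateConfig_hullConfig hV hl φ,
      isPeriodicConfig_hullConfig_rat hp hq φ⟩
  · intro V hV l φ hl hirr
    exact ⟨isMostHomogeneous_hullConfig hl φ, isCanonicalGroundStateConfig_hullConfig hV hl φ,
      not_isPeriodicConfig_hullConfig hl hirr φ⟩

/-- Consistency with the parent entry: the narrowed clauses (2)–(3) are instances of
`Hubbard1978_mostHomogeneous` (now a theorem), specialised to Aubry's hull configurations, plus
the periodicity dichotomy; conversely every `q`-periodic-up-to-translation enumeration has the
rational mean gap `q/p` (`mean_gap_of_periodic`), so clause (3)'s configurations lie outside the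
reach of any periodic ansatz. [cite: JedrzejewskiMiekisz2000, §2 (p. 6)] -/
theorem Hubbard1978_mostHomogeneous.hullConfig (h : Hubbard1978_mostHomogeneous) {V : ℕ → ℝ}
    (hV : IsHubbardPotential V) {l : ℝ} (hl : 1 ≤ l) (φ : ℝ) :
    IsCanonicalGroundStateConfig V (configOf (hullConfig l φ)) :=
  h V hV _ (isMostHomogeneous_hullConfig hl φ)

end Literature.Barriers.AtomisticToContinuum.HubbardChain

end
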